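import Summits.BirchSwinnertonDyer.BirchSwinnertonDyer.Theses.SlopeDichotomyA2

/-!
# BC3 birth skeleton — crux `DegenerateLocusA2` of route `SlopeDichotomyA2`
(published as `Summits/BirchSwinnertonDyer/BirchSwinnertonDyer/Cruxes/DegenerateLocusA2/Lines/birth.lean`).

Two named stubs + the kernel-checked composition concluding the route decl
`Summit.BirchSwinnertonDyer.BirchSwinnertonDyer.Theses.SlopeDichotomyA2.DegenerateLocusA2` BY NAME.

* `stub_classicalClausesA2` — the three CLASSICAL clauses of `BSDp W p` on corner A2 (rank part by
  Gross–Zagier–Kolyvagin `rank_eq_analyticRank_of_analyticRank_le_one`, finiteness of `Ш[p^∞]`, rationality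
  `#Ш_an ∈ ℚ` in analytic rank one, GZ86). Known complement (residual-known), size M, provable from named facts.
* `stub_pPartOnDegenerateLocusA2` — THE OPEN CONTENT: Miller's clause (iv)
  `ord_p #Ш_an = ord_p #Ш[p^∞]` on the DEGENERATE LOCUS of A2 (some canonical cyclotomic `p`-adic height datum
  violates `SchneiderConjecture`). Intended proof = the β-road (critical-slope main conjecture + Perrin-Riou
  leading term + β-`p`-adic Gross–Zagier à la Büyükboduk–Pollack–Sasaki arXiv:1811.08216 Cor. 1.1.2 MINUS its
  absolute-irreducibility hypothesis), entered through `h_β(P₀) ≠ 0` forced by degeneracy of `h_α`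
  (slope-gap identity; kit census j244598: `h_α ≠ 0 ∧ h_β ≠ 0` on 2 797 / 2 797 A2 class-pairs, `N < 5·10⁵`).
  This stub is also the BC5 PLAN-ONLY rung (`T3-plan-only`): the crux is conjecturally VACUOUS (Schneider 1985),
  so no decided instance outside S's known regime exists in print; the CM case is inside S's regime
  (`SchneiderWeaken.not_degenerate_of_hasCM`) and is NOT offered as a witness.

CONJUNCT SPLIT, declared: stub 2 is clause (iv) of the crux restricted to the degenerate locus; stub 1 is the
known complement. Neither stub alone gives the crux or the leaf `SchneiderWeaken.TypeBRankOneUnridered`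
(BC3 stub probes: `bc/BC3_stub_probes_leaf.lean` against the landed leaf statements and `bc/BC3_stub_probes_route.lean` against this route file — each stub → crux / stub → leaf example MUST FAIL; 4/4 FAIL as required).
-/

noncomputable section

open scoped Classical

namespace Summit.BirchSwinnertonDyer.BirchSwinnertonDyer.Cruxes.DegenerateLocusA2.Birth

/-- stub 1 (known complement; GZK = `rank_eq_analyticRank_of_analyticRank_le_one`, GZ86 rationality). -/
theorem stub_classicalClausesA2 :
    ∀ (W : WeierstrassCurve ℚ) [W.IsElliptic] [W.IsGloballyMinimal] (p : ℕ) [Fact p.Prime],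
      Summit.BirchSwinnertonDyer.Rank1Residual.X1.TypeBRankOne W p →
        W.mordellWeilRank = W.analyticRank ∧ Finite (AddCommGroup.primaryComponent W.sha p) ∧
          ∃ q : ℚ, Literature.NumberTheory.EllipticCurves.shaAn W = (q : ℂ) := by
  sorry

/-- stub 2 (THE OPEN CONTENT: clause (iv) on the degenerate locus; β-road; BC5 plan-only rung). -/
theorem stub_pPartOnDegenerateLocusA2 :
    ∀ (W : WeierstrassCurve ℚ) [W.IsElliptic] [W.IsGloballyMinimal] (p : ℕ) [Fact p.Prime],
      Summit.BirchSwinnertonDyer.Rank1Residual.X1.TypeBRankOne W p →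
        (∃ Dh : WeierstrassCurve.PAdicHeightData W p, Dh.IsCanonical ∧ ¬ WeierstrassCurve.SchneiderConjecture Dh) →
          Finite (AddCommGroup.primaryComponent W.sha p) →
            ∀ q : ℚ, Literature.NumberTheory.EllipticCurves.shaAn W = (q : ℂ) →
              padicValRat p q = padicValNat p (Nat.card (AddCommGroup.primaryComponent W.sha p)) := by
  sorry

/-- COMPOSITION (kernel-checked, no sorry): stub 1 → stub 2 → the crux BY NAME. -/
theorem DegenerateLocusA2_of
    (h1 : ∀ (W : WeierstrassCurve ℚ) [W.IsElliptic] [W.IsGloballyMinimal] (p : ℕ) [Fact p.Prime],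
      Summit.BirchSwinnertonDyer.Rank1Residual.X1.TypeBRankOne W p →
        W.mordellWeilRank = W.analyticRank ∧ Finite (AddCommGroup.primaryComponent W.sha p) ∧
          ∃ q : ℚ, Literature.NumberTheory.EllipticCurves.shaAn W = (q : ℂ))
    (h2 : ∀ (W : WeierstrassCurve ℚ) [W.IsElliptic] [W.IsGloballyMinimal] (p : ℕ) [Fact p.Prime],
      Summit.BirchSwinnertonDyer.Rank1Residual.X1.TypeBRankOne W p →
        (∃ Dh : WeierstrassCurve.PAdicHeightData W p, Dh.IsCanonical ∧ ¬ WeierstrassCurve.SchneiderConjecture Dh) →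
          Finite (AddCommGroup.primaryComponent W.sha p) →
            ∀ q : ℚ, Literature.NumberTheory.EllipticCurves.shaAn W = (q : ℂ) →
              padicValRat p q = padicValNat p (Nat.card (AddCommGroup.primaryComponent W.sha p))) :
    Summit.BirchSwinnertonDyer.BirchSwinnertonDyer.Theses.SlopeDichotomyA2.DegenerateLocusA2 := by
  intro W _ _ p _ hB hdeg
  obtain ⟨hrank, hfin, q, hq⟩ := h1 W p hB
  exact ⟨hrank, hfin, q, hq, h2 W p hB hdeg hfin q hq⟩

/-- the composition applied to the stubs: the skeleton concludes the crux BY NAME. -/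
theorem DegenerateLocusA2_of_stubs :
    Summit.BirchSwinnertonDyer.BirchSwinnertonDyer.Theses.SlopeDichotomyA2.DegenerateLocusA2 :=
  DegenerateLocusA2_of stub_classicalClausesA2 stub_pPartOnDegenerateLocusA2

end Summit.BirchSwinnertonDyer.BirchSwinnertonDyer.Cruxes.DegenerateLocusA2.Birth

end
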